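import Literature.Geometry.Lorentzian.SchoenYauStableSurface
import Literature.Geometry.Lorentzian.AsymptoticallySchwarzschildDecay
import Literature.Geometry.Lorentzian.EndRadius
import HarnessLib

/-!
# Schoen–Yau 1979, §2, Step 3, (2.16)–(2.18) for a stable minimal surface in a one-ended
# asymptotically Schwarzschildean manifold

Schoen–Yau, Comm. Math. Phys. 65 (1979), §2, Step 3, pp. 52–55, in the setting of Theorem 1:
`(N³, ds²)` with one end on which (1.1) `ds² = (1 + M/2r)⁴δ + O₂(r⁻²)` holds and `R ≥ 0`, and a
properly immersed minimal surface `S` which is stable ((2.13)) and has quadratic area growth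
((2.9)). This file assembles the pieces proved in the tree into the statement of (2.16)–(2.18)
**in the vocabulary of the positive mass theorem** (`AFEnd`, `InitialDataSet`,
`IsAsymptoticallySchwarzschild`, `IsSoleEnd`):

* `SchoenYau.curvature_integrals_of_stable_minimal_end` — for data `D` on `X` with one end `e`,
  asymptotically Schwarzschildean to second order and `R ≥ 0`, and a smooth proper minimal
  immersion `f : N² → X` with unit normal `ν` (smooth lift) satisfying the stability inequality
  (2.13) for all smooth compactly supported test functions and the area growth
  `Area(f⁻¹(X ∖ far t)) ≤ C t²` (`t ≥ 1`): `‖A‖², K, R∘f ∈ L¹(Area)`, `½ ∫ (R + ‖A‖²) ≤ ∫ K`,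
  and `0 < ½ ∫ (R + ‖A‖²)` as soon as `{R∘f > 0}` has positive area.

Ingredients: the extended radius `r'` (`AFEnd.exists_smooth_properRadius`, `EndRadius.lean`),
the decay `K₁₂ = O(r⁻³)`
(`IsAsymptoticallySchwarzschild.exists_bound_half_scalarCurvature_sub_ricci`,
`AsymptoticallySchwarzschildDecay.lean`; on the compact core `K₁₂ = K + ‖A‖²/2` is bounded by
continuity, via the traced Gauss equation), and `SchoenYau.curvature_integrals_of_stable_minimal`
(`SchoenYauStableSurface.lean`). Everything is proved; no definitions, no named facts. What is
still missing for the hypothesis `h₂₃` (Steps 2–3) of `schoenYau_mass_nonneg_of_steps23` is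
recorded in the module docstring of `SchoenYauStableSurface.lean` (existence of `S`, (2.9) and
(2.13) from the minimising property, and the Claim `∫_S K ≤ 0` with Remark 2.1).

## References

* R. Schoen, S.-T. Yau, *On the proof of the positive mass conjecture in general relativity*,
  Comm. Math. Phys. 65 (1979) 45–76: §2, Step 3, (2.9)–(2.18), pp. 52–55. [SchoenYauPMT1979]
-/

noncomputable section

open Bundle Set Filter Function Manifold MeasureTheory Module
open scoped Manifold ContDiff Topology

namespace Literature.Geometry.Lorentzian

namespace SchoenYau

open PseudoRiemannianMetric

variable {X : Type} [TopologicalSpace X] [ChartedSpace E3 X] [IsManifold (𝓡 3) ∞ X]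
  (D : InitialDataSet (𝓡 3) X) [D.metric.HasLeviCivita] (e : AFEnd X)
  {E' : Type*} [NormedAddCommGroup E'] [NormedSpace ℝ E'] {H' : Type*} [TopologicalSpace H']
  {I' : ModelWithCorners ℝ E' H'} {N : Type*} [TopologicalSpace N] [ChartedSpace H' N]
  [IsManifold I' ∞ N] [FiniteDimensional ℝ E'] [CompleteSpace E'] [I'.Boundaryless]
  [T3Space N] [MeasurableSpace N] [BorelSpace N]

/-- `max t R ≤ max 1 R · t` for `t ≥ 1`. [folklore] -/
theorem max_le_max_one_mul {t R : ℝ} (ht : 1 ≤ t) : max t R ≤ max 1 R * t := by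
  rcases le_total t R with h | h
  · rw [max_eq_right h]
    calc R ≤ max 1 R := le_max_right _ _
      _ = max 1 R * 1 := (mul_one _).symm
      _ ≤ max 1 R * t := by gcongr
  · rw [max_eq_left h]
    calc t = 1 * t := (one_mul _).symm
      _ ≤ max 1 R * t := by gcongr; exact le_max_left _ _

/-- **Schoen–Yau 1979, §2, Step 3, (2.13) ⟹ (2.16)–(2.18), in the setting of Theorem 1.** Let
`D` be data on the `3`-manifold `X` with one end `e` (`e.IsSoleEnd`), asymptotically
Schwarzschildean of mass `M` to second order ((1.1), `IsAsymptoticallySchwarzschild e D M 2`),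
with `R ≥ 0`. Let `f : N² → X` be a smooth proper minimal immersion of a surface (spacelike =
Riemannian immersion with induced metric `f^*h`, unit normal field `ν` with smooth lift,
vanishing mean curvature (2.12)), with the area growth (2.9) `Area(f⁻¹(X ∖ far t)) ≤ C t²` for
`t ≥ 1` and the stability inequality (2.13) `∫ (Ric(ν,ν) + ‖A‖²) u² ≤ ∫ ‖∇u‖²` for all smooth
compactly supported `u` on `N`. Then ((2.16)–(2.18)): `‖A‖² ∈ L¹`, the Gauss curvature
`K = S_{f^*h}/2 ∈ L¹`, `R ∘ f ∈ L¹`, `½ ∫ (R + ‖A‖²) dArea ≤ ∫ K dArea`, and the left side is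
positive whenever `{R ∘ f > 0}` has positive area ("`R > 0` outside a compact subset of `S`").
Proof: Schoen–Yau's extended radius `r'` (`AFEnd.exists_smooth_properRadius`: smooth, `≥ 1`,
`‖∇r'‖² ≤ C₃`, proper, `= r` far out), the decay `K₁₂ = R/2 − Ric(ν,ν) = O(r⁻³)` from (1.1)
(`exists_bound_half_scalarCurvature_sub_ricci`; bounded on the compact core, where by the
traced Gauss equation `R/2 − Ric(ν,ν) = K + ‖A‖²/2` is continuous), and
`curvature_integrals_of_stable_minimal`.
[cite: SchoenYauPMT1979, §2, Step 3, pp. 52–55, (2.16)–(2.18)] -/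
theorem curvature_integrals_of_stable_minimal_end {M : ℝ}
    (hAS : IsAsymptoticallySchwarzschild e D M 2) (hsole : e.IsSoleEnd)
    (hR0 : ∀ x : X, 0 ≤ D.metric.scalarCurvature x) (h2 : Module.finrank ℝ E' = 2)
    {f : N → X} (hpb : contMDiff_pullbackBilin (𝓡 3) X I' N ∞)
    (hfi : D.metric.IsSpacelikeImmersion I' f)
    (hprop : ∀ K : Set X, IsCompact K → IsCompact (f ⁻¹' K))
    {ν : NormalField (𝓡 3) f}
    (hν : ContMDiff I' (𝓡 3).tangent ∞
      (fun x ↦ (TotalSpace.mk' E3 (f x) (ν x) : TangentBundle (𝓡 3) X)))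
    (hun : D.metric.IsUnitNormal I' f ν 1) (hmin : D.metric.IsMaximalSlice f hpb hfi ν)
    (hgrowth : ∃ C : ℝ, ∀ t : ℝ, 1 ≤ t →
      riemannianMeasure (D.metric.inducedRiemannianMetric f hpb hfi) (f ⁻¹' (e.far t)ᶜ) ≤
        ENNReal.ofReal (C * t ^ 2))
    (hstab : ∀ u : N → ℝ, CMDiff ∞ u → HasCompactSupport u →
      ∫ y, (D.metric.ricci (f y) (ν y) (ν y) +
          (D.metric.inducedMetric f hpb hfi).normSq y (D.metric.secondFundamentalForm I' f ν y)) *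
          u y ^ 2 ∂(riemannianMeasure (D.metric.inducedRiemannianMetric f hpb hfi)) ≤
      ∫ y, (D.metric.inducedMetric f hpb hfi).gradSq u y
        ∂(riemannianMeasure (D.metric.inducedRiemannianMetric f hpb hfi))) :
    haveI := (D.metric.inducedMetric f hpb hfi).hasLeviCivita
    Integrable (fun y ↦ D.metric.scalarCurvature (f y))
        (riemannianMeasure (D.metric.inducedRiemannianMetric f hpb hfi)) ∧
      Integrable (fun y ↦ (D.metric.inducedMetric f hpb hfi).normSq y
          (D.metric.secondFundamentalForm I' f ν y))
        (riemannianMeasure (D.metric.inducedRiemannianMetric f hpb hfi)) ∧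
      Integrable (fun y ↦ (D.metric.inducedMetric f hpb hfi).scalarCurvature y / 2)
        (riemannianMeasure (D.metric.inducedRiemannianMetric f hpb hfi)) ∧
      (1 / 2) * ∫ y, (D.metric.scalarCurvature (f y) +
          (D.metric.inducedMetric f hpb hfi).normSq y (D.metric.secondFundamentalForm I' f ν y))
          ∂(riemannianMeasure (D.metric.inducedRiemannianMetric f hpb hfi)) ≤
        ∫ y, (D.metric.inducedMetric f hpb hfi).scalarCurvature y / 2
          ∂(riemannianMeasure (D.metric.inducedRiemannianMetric f hpb hfi)) ∧
      (riemannianMeasure (D.metric.inducedRiemannianMetric f hpb hfi)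
          {y | 0 < D.metric.scalarCurvature (f y)} ≠ 0 →
        0 < (1 / 2) * ∫ y, (D.metric.scalarCurvature (f y) +
          (D.metric.inducedMetric f hpb hfi).normSq y (D.metric.secondFundamentalForm I' f ν y))
          ∂(riemannianMeasure (D.metric.inducedRiemannianMetric f hpb hfi))) := by
  haveI := (D.metric.inducedMetric f hpb hfi).hasLeviCivita
  set g := D.metric with hgdef
  set gN := g.inducedMetric f hpb hfi with hgN
  set μ := riemannianMeasure (g.inducedRiemannianMetric f hpb hfi) with hμ
  have hg : g.IsRiemannian := D.isRiemannian_metric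
  have h3 : Module.finrank ℝ E3 = 3 := finrank_euclideanSpace_fin
  have hf : ContMDiff I' (𝓡 3) ∞ f := hfi.contMDiff_self
  -- Schoen–Yau's extended radius `r'`
  obtain ⟨ρ, R₂, C₃, hR₂, hρs, hρ1, hgrad, hcpt, hfar⟩ :=
    e.exists_smooth_properRadius D one_pos hAS.isMetricAsymptoticallyFlat hsole
  have hρc : Continuous ρ := hρs.continuous
  -- the decay of `K₁₂` far out
  obtain ⟨Λ, R₁, hR₁, -, hK⟩ := hAS.exists_bound_half_scalarCurvature_sub_ricci
  -- `K₁₂ = K + ‖A‖²/2` along `f` is continuous (traced Gauss equation, `H = 0`)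
  set a : N → ℝ := fun y ↦ gN.normSq y (g.secondFundamentalForm I' f ν y) with ha
  set Kf : N → ℝ := fun y ↦ gN.scalarCurvature y / 2 with hKf
  set φ : N → ℝ := fun y ↦ g.scalarCurvature (f y) / 2 - g.ricci (f y) (ν y) (ν y) with hφ
  have hGauss : ∀ y, φ y = Kf y + a y / 2 := by
    intro y
    have h := g.scalarCurvature_inducedMetric_eq hpb hfi hν hun one_ne_zero h2 h3 y
    rw [hmin y] at h
    simp only [hφ, hKf, ha]
    rw [h]
    ring
  have hφc : Continuous φ := by
    have h1 : Continuous Kf := gN.contMDiff_scalarCurvature.continuous.div_const 2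
    have h2' : Continuous a := (g.contMDiff_normSq_secondFundamentalForm hpb hfi ν hν).continuous
    have : φ = fun y ↦ Kf y + a y / 2 := funext hGauss
    rw [this]
    exact h1.add (h2'.div_const 2)
  -- the compact core part of `S`
  set s : ℝ := max R₁ R₂ with hs
  have hS₀ : IsCompact (f ⁻¹' (e.far s)ᶜ) := hprop _ (AFEnd.isCompact_compl_far hsole s)
  obtain ⟨B, hB⟩ := hS₀.exists_bound_of_continuousOn hφc.continuousOn
  obtain ⟨T, hT⟩ := (AFEnd.isCompact_compl_far hsole s).exists_bound_of_continuousOn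
    hρc.continuousOn
  have hB0 : 0 ≤ max B 0 := le_max_right _ _
  have hT0 : 0 ≤ max T 0 := le_max_right _ _
  set Λ' : ℝ := max (max Λ 0) (max B 0 * max T 0 ^ 3) with hΛ'
  have hK12 : ∀ y : N, |g.scalarCurvature (f y) / 2 - g.ricci (f y) (ν y) (ν y)| ≤
      Λ' * (ρ (f y))⁻¹ ^ 3 := by
    intro y
    have hρy : 1 ≤ ρ (f y) := hρ1 _
    have hinv0 : 0 ≤ (ρ (f y))⁻¹ ^ 3 := by positivity
    by_cases hy : f y ∈ e.far s
    · -- far out: `f y = Φ z`, `ρ (f y) = ‖z‖ ≥ R₁`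
      obtain ⟨hyU, hys⟩ := e.mem_far_iff_coord.1 hy
      have hz1 : R₁ ≤ ‖e.coord (f y)‖ := (le_max_left _ _).trans hys.le
      have hyfar : f y ∈ e.far R₂ :=
        e.mem_far_iff_coord.2 ⟨hyU, (le_max_right _ _).trans_lt hys⟩
      have hρeq : ρ (f y) = ‖e.coord (f y)‖ := hfar _ hyfar
      have hx : e.dataChartExt (e.coord (f y)) = f y := by
        rw [e.dataChartExt_of_lt (e.lt_norm_coord hyU), e.dataChart_coord hyU]
      have hKy := hK (e.coord (f y)) hz1
      rw [hx] at hKy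
      have h := hKy (ν y) (hun.2 y)
      rw [hρeq]
      refine h.trans (mul_le_mul_of_nonneg_right ?_ (by positivity))
      exact (le_max_left _ _).trans (le_max_left _ _)
    · -- on the compact core: bounded by continuity
      have hyS : y ∈ f ⁻¹' (e.far s)ᶜ := hy
      have hφy : |φ y| ≤ max B 0 :=
        ((Real.norm_eq_abs _).symm.le.trans (hB y hyS)).trans (le_max_left _ _)
      have hρT : ρ (f y) ≤ max T 0 :=
        ((le_abs_self _).trans ((Real.norm_eq_abs _).symm.le.trans (hT (f y) hy))).trans
          (le_max_left _ _)
      have hTpos : 0 < max T 0 := lt_of_lt_of_le (lt_of_lt_of_le one_pos hρy) hρT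
      -- `max B 0 ≤ (max B 0) (max T 0)³ ρ⁻³` since `ρ ≤ max T 0`
      have hkey : max B 0 ≤ max B 0 * max T 0 ^ 3 * (ρ (f y))⁻¹ ^ 3 := by
        have hρpos : 0 < ρ (f y) := lt_of_lt_of_le one_pos hρy
        have h1 : 1 ≤ max T 0 * (ρ (f y))⁻¹ := by
          rw [le_mul_inv_iff₀ hρpos, one_mul]; exact hρT
        have h3' : 1 ≤ (max T 0 * (ρ (f y))⁻¹) ^ 3 := one_le_pow₀ h1
        calc max B 0 = max B 0 * 1 := (mul_one _).symm
          _ ≤ max B 0 * (max T 0 * (ρ (f y))⁻¹) ^ 3 := by gcongr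
          _ = max B 0 * max T 0 ^ 3 * (ρ (f y))⁻¹ ^ 3 := by ring
      calc |g.scalarCurvature (f y) / 2 - g.ricci (f y) (ν y) (ν y)| = |φ y| := rfl
        _ ≤ max B 0 * max T 0 ^ 3 * (ρ (f y))⁻¹ ^ 3 := hφy.trans hkey
        _ ≤ Λ' * (ρ (f y))⁻¹ ^ 3 := mul_le_mul_of_nonneg_right (le_max_right _ _) hinv0
  -- properness of `ρ ∘ f`
  have hproper : ∀ t : ℝ, IsCompact {y : N | ρ (f y) ≤ t} := fun t ↦ hprop _ (hcpt t)
  -- area growth along `ρ ∘ f`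
  obtain ⟨C, hC⟩ := hgrowth
  set C' : ℝ := max C 0 * max 1 R₂ ^ 2 with hC'
  have hC'0 : 0 ≤ C' := by positivity
  have hG : ∀ t : ℝ, 1 ≤ t → μ {y | ρ (f y) ≤ t} ≤ ENNReal.ofReal (C' * t ^ 2) := by
    intro t ht
    have hsub : {y | ρ (f y) ≤ t} ⊆ f ⁻¹' (e.far (max t R₂))ᶜ := by
      intro y (hy : ρ (f y) ≤ t) (hfy : f y ∈ e.far (max t R₂))
      obtain ⟨hyU, hys⟩ := e.mem_far_iff_coord.1 hfy
      have hyfar : f y ∈ e.far R₂ :=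
        e.mem_far_iff_coord.2 ⟨hyU, (le_max_right _ _).trans_lt hys⟩
      have := hfar _ hyfar
      have : t < ρ (f y) := by rw [this]; exact (le_max_left _ _).trans_lt hys
      linarith
    have ht1 : 1 ≤ max t R₂ := ht.trans (le_max_left _ _)
    calc μ {y | ρ (f y) ≤ t} ≤ μ (f ⁻¹' (e.far (max t R₂))ᶜ) := measure_mono hsub
      _ ≤ ENNReal.ofReal (C * max t R₂ ^ 2) := hC _ ht1
      _ ≤ ENNReal.ofReal (C' * t ^ 2) := by
          refine ENNReal.ofReal_le_ofReal ?_
          calc C * max t R₂ ^ 2 ≤ max C 0 * max t R₂ ^ 2 :=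
                mul_le_mul_of_nonneg_right (le_max_left _ _) (by positivity)
            _ ≤ max C 0 * (max 1 R₂ * t) ^ 2 := by
                gcongr
                exact max_le_max_one_mul ht
            _ = C' * t ^ 2 := by rw [hC']; ring
  -- Step 3 on the stable minimal surface
  exact curvature_integrals_of_stable_minimal g hg h3 h2 hpb hfi hν hun hmin hρs hρ1 hgrad
    hproper hC'0 hG (fun y ↦ hR0 (f y)) hK12 hstab

end SchoenYau

end Literature.Geometry.Lorentzian

end
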